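import Literature.NumberTheory.LFunctions.IdealNormCount
import HarnessLib

/-!
# Dirichlet density with convergent remainder ("strong Dirichlet density") of sets of primes

Topic `Literature/NumberTheory/LFunctions`. Everything in this file is PROVED (no `sorry`).

For a number field `M` and a set `X` of nonzero primes `𝔮` of `𝓞 M` (`HeightOneSpectrum (𝓞 M)`)
we consider the *degree-one* prime Dirichlet series

  `D_X(s) = Σ_{𝔮 ∈ X, N𝔮 prime} N𝔮^{-s} = Σ_p #{𝔮 ∈ X : N𝔮 = p} · p^{-s}`   (`s > 1` real)

and say that `X` **has strong Dirichlet density `c`** (`Literature.HasStrongDirichletDensity M X c`)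
when the remainder `D_X(s) + c · log (s - 1)` converges to a finite limit as `s → 1⁺`.  Since
`Σ_𝔮 N𝔮^{-s} + log (s-1)` converges as `s → 1⁺` and the primes of degree `≥ 2` contribute a
function continuous at `s = 1` (Neukirch, *Algebraic Number Theory*, VII (13.1) and the proof of
(13.2); Marcus, *Number Fields*, Ch. 7; Narkiewicz, *Elementary and Analytic Theory of Algebraic
Numbers*, Ch. 7 §1), this is a strengthening (convergent remainder instead of `o(log 1/(s-1))`)
of "`X` has Dirichlet density `c`" in the sense of Neukirch VII (13.1) / Serre, *Cours
d'arithmétique* VI.4.1 (cf. `Literature.NumberTheory.LFunctions.HasDirichletDensity` of `LFunctions/ChebotarevDensity.lean` for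
sets of rational primes).  It is NOT the classical "logarithmic density"
(`(1/log x) Σ_{n ≤ x, n ∈ X} 1/n`), a different notion.  It is the form in which densities are
produced by `log ζ`-arguments and the form consumed by Frobenius' density theorem (planned:
`GaloisRepresentations/FrobeniusDensity.lean`).

Main definitions and results:

* `Literature.primeSeries f s = Σ_p f(p) p^{-s}` and `Literature.HasPrimeLogAsymp f c` (the abstract notion
  for a coefficient function `f : ℕ → ℝ` on the rational primes), with the calculus
  `HasPrimeLogAsymp.linear` (finite linear combinations, up to finitely many primes) and
  `HasPrimeLogAsymp.infinite` (`c > 0` forces infinitely many `p` with `f p ≠ 0`);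
  `hasPrimeLogAsymp_one` is `Σ_p p^{-s} + log (s-1) → L`
  (tree: `exists_tendsto_tsum_primes_rpow_add_log`).
* `Literature.primesOfNorm M p` (the finite set of primes of `𝓞 M` of absolute norm `p`),
  `Literature.primeNormCount M X p = #{𝔮 ∈ X : N𝔮 = p}`, `Literature.HasStrongDirichletDensity M X c`.
* `Literature.NumberTheory.LFunctions.hasStrongDirichletDensity_univ`: **the set of all primes of `M` has strong Dirichlet
  density `1`**, i.e. `Σ_{N𝔮 = p prime} N𝔮^{-s} + log (s-1)` converges as `s → 1⁺` — the tree's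
  `exists_tendsto_tsum_primes_idealNormCount_add_log` (`IdealNormCount.lean`: `log ζ_M` at `1⁺`
  through the Euler product and Mathlib's class number formula residue
  `NumberField.tendsto_sub_one_mul_dedekindZeta_nhdsGT`), repackaged.
* `Literature.NumberTheory.LFunctions.HasStrongDirichletDensity.infinite`: a set of positive strong Dirichlet density is
  infinite;
  `Literature.NumberTheory.LFunctions.hasStrongDirichletDensity_of_forall_indicator_eq` (linear combinations / finite modifications) and
  `Literature.NumberTheory.LFunctions.hasStrongDirichletDensity_of_primeNormCount_eq` (comparison of counts between two number fields,
  the shape in which splitting laws transfer densities).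

## References

* J. Neukirch, *Algebraic Number Theory*, Grundlehren 322, Springer 1999, Ch. VII §13,
  (13.1)–(13.2). [NeukirchANT1999]
* D. A. Marcus, *Number Fields*, Springer 1977, Ch. 7 (polar density). [folklore]
* J.-P. Serre, *Cours d'arithmétique*, PUF 1970, Ch. VI §4.1. [folklore]
-/

noncomputable section

open Filter Topology NumberField IsDedekindDomain

open scoped Classical

namespace Literature.NumberTheory.LFunctions

/-! ### Prime Dirichlet series with bounded coefficients -/

/-- The prime Dirichlet series `Σ_p f(p) p^{-s}` (sum over the rational primes) of a coefficient
function `f`, at a real point `s`. [folklore] -/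
def primeSeries (f : ℕ → ℝ) (s : ℝ) : ℝ := ∑' p : Nat.Primes, f p * (p : ℝ) ^ (-s)

/-- Unfolding lemma for `primeSeries`. [folklore] -/
theorem primeSeries_def (f : ℕ → ℝ) (s : ℝ) :
    primeSeries f s = ∑' p : Nat.Primes, f p * (p : ℝ) ^ (-s) := rfl

/-- `f` **has logarithmic prime asymptotic `c`**: `Σ_p f(p) p^{-s} + c · log (s - 1)` converges
to a finite limit `L` as `s → 1⁺` (i.e. `Σ_p f(p) p^{-s} = c · log (1/(s-1)) + L + o(1)`; the
remainder converges, which is stronger than `O(1)`). Neukirch, *Algebraic Number Theory*,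
VII (13.1). [folklore] -/
def HasPrimeLogAsymp (f : ℕ → ℝ) (c : ℝ) : Prop :=
  ∃ L : ℝ, Tendsto (fun s : ℝ => primeSeries f s + c * Real.log (s - 1)) (𝓝[>] 1) (𝓝 L)

/-- Summability of `Σ_p f(p) p^{-s}` for bounded `f` and `s > 1`. [folklore] -/
theorem summable_primes_mul_rpow_of_bounded {f : ℕ → ℝ} {B : ℝ}
    (hf : ∀ p : Nat.Primes, |f p| ≤ B) {s : ℝ} (hs : 1 < s) :
    Summable fun p : Nat.Primes => f p * (p : ℝ) ^ (-s) := by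
  have hsum : Summable fun p : Nat.Primes => B * (p : ℝ) ^ (-s) :=
    (Nat.Primes.summable_rpow.mpr (by linarith)).mul_left B
  refine Summable.of_norm_bounded hsum fun p => ?_
  rw [Real.norm_eq_abs, abs_mul, abs_of_nonneg (Real.rpow_nonneg (Nat.cast_nonneg _) _)]
  exact mul_le_mul_of_nonneg_right (hf p) (Real.rpow_nonneg (Nat.cast_nonneg _) _)

/-- Continuity of `s ↦ p^{-s}`. [folklore] -/
theorem continuous_natCast_rpow_neg (p : ℕ) (hp : p ≠ 0) :
    Continuous fun s : ℝ => (p : ℝ) ^ (-s) :=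
  (Real.continuous_const_rpow (Nat.cast_ne_zero.mpr hp)).comp continuous_neg

/-- A finitely supported prime Dirichlet series is continuous (in particular at `s = 1`).
[folklore] -/
theorem continuous_finsetSum_mul_rpow (T : Finset Nat.Primes) (d : Nat.Primes → ℝ) :
    Continuous fun s : ℝ => ∑ p ∈ T, d p * (p : ℝ) ^ (-s) :=
  continuous_finsetSum T fun p _ =>
    continuous_const.mul (continuous_natCast_rpow_neg p p.prop.ne_zero)

/-- `Σ_p p^{-s} + log (s-1)` converges as `s → 1⁺` (tree:
`exists_tendsto_tsum_primes_rpow_add_log`, from `log ζ(s)`). [folklore] -/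
theorem hasPrimeLogAsymp_one : HasPrimeLogAsymp (fun _ => 1) 1 := by
  obtain ⟨L, hL⟩ := exists_tendsto_tsum_primes_rpow_add_log
  refine ⟨L, hL.congr' ?_⟩
  filter_upwards with s
  simp [primeSeries]

/-- **Linear combinations.** If `g = Σ_{i ∈ S} a_i f_i` at all but finitely many primes, the
`f_i` are bounded on primes and `f_i` has logarithmic prime asymptotic `c_i`, then `g` has
logarithmic prime asymptotic `Σ a_i c_i`: the discrepancy is a finite Dirichlet polynomial,
continuous at `s = 1`. (The boundedness hypothesis `hg` on `g` follows from `hb` and `heq`; it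
is kept as an explicit argument for convenience of use.) [folklore] -/
theorem HasPrimeLogAsymp.linear {ι : Type*} (S : Finset ι) {f : ι → ℕ → ℝ} {c : ι → ℝ}
    {B : ι → ℝ} (hb : ∀ i ∈ S, ∀ p : Nat.Primes, |f i p| ≤ B i)
    (h : ∀ i ∈ S, HasPrimeLogAsymp (f i) (c i)) (a : ι → ℝ) {g : ℕ → ℝ} {Bg : ℝ}
    (hg : ∀ p : Nat.Primes, |g p| ≤ Bg)
    (heq : ∀ᶠ p : Nat.Primes in cofinite, g p = ∑ i ∈ S, a i * f i p) :
    HasPrimeLogAsymp g (∑ i ∈ S, a i * c i) := by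
  choose L₀ hL₀ using h
  set L : ι → ℝ := fun i => if hi : i ∈ S then L₀ i hi else 0 with hLdef
  have hL : ∀ i ∈ S, Tendsto (fun s : ℝ => primeSeries (f i) s + c i * Real.log (s - 1))
      (𝓝[>] 1) (𝓝 (L i)) := fun i hi => by
    simp only [hLdef, dif_pos hi]
    exact hL₀ i hi
  -- the finite exceptional set and the correction polynomial
  rw [Filter.eventually_cofinite] at heq
  set T : Finset Nat.Primes := heq.toFinset with hT
  set d : Nat.Primes → ℝ := fun p => g p - ∑ i ∈ S, a i * f i p with hd
  have hd0 : ∀ p : Nat.Primes, p ∉ T → d p = 0 := by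
    intro p hp
    rw [hT, Set.Finite.mem_toFinset] at hp
    simp only [Set.mem_setOf_eq, not_not] at hp
    simp [hd, hp]
  set R : ℝ → ℝ := fun s => ∑ p ∈ T, d p * (p : ℝ) ^ (-s) with hR
  have hRcont : Continuous R := continuous_finsetSum_mul_rpow T d
  -- decomposition of the series for `s > 1`
  have hdec : ∀ s : ℝ, 1 < s →
      primeSeries g s = ∑ i ∈ S, a i * primeSeries (f i) s + R s := by
    intro s hs
    have hsg := summable_primes_mul_rpow_of_bounded hg hs
    have hsf : ∀ i ∈ S, Summable fun p : Nat.Primes => a i * (f i p * (p : ℝ) ^ (-s)) :=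
      fun i hi => (summable_primes_mul_rpow_of_bounded (hb i hi) hs).mul_left (a i)
    have hsd : Summable fun p : Nat.Primes => d p * (p : ℝ) ^ (-s) :=
      summable_of_ne_finset_zero (s := T) fun p hp => by rw [hd0 p hp, zero_mul]
    have hpt : ∀ p : Nat.Primes, g p * (p : ℝ) ^ (-s) =
        (∑ i ∈ S, a i * (f i p * (p : ℝ) ^ (-s))) + d p * (p : ℝ) ^ (-s) := by
      intro p
      simp only [hd]
      rw [sub_mul, Finset.sum_mul]
      have : ∑ i ∈ S, a i * f i p * (p : ℝ) ^ (-s) = ∑ i ∈ S, a i * (f i p * (p : ℝ) ^ (-s)) :=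
        Finset.sum_congr rfl fun i _ => by ring
      rw [this]
      ring
    rw [primeSeries_def, tsum_congr hpt, (summable_sum hsf).tsum_add hsd,
      Summable.tsum_finsetSum hsf,
      tsum_eq_sum (s := T) (fun p hp => by rw [hd0 p hp, zero_mul])]
    congr 1
    refine Finset.sum_congr rfl fun i hi => ?_
    rw [tsum_mul_left, primeSeries_def]
  -- pass to the limit
  refine ⟨∑ i ∈ S, a i * L i + R 1, ?_⟩
  have hlim : Tendsto (fun s : ℝ => ∑ i ∈ S, a i * (primeSeries (f i) s + c i * Real.log (s - 1))
      + R s) (𝓝[>] 1) (𝓝 (∑ i ∈ S, a i * L i + R 1)) := by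
    refine Tendsto.add (tendsto_finsetSum S fun i hi => (hL i hi).const_mul (a i)) ?_
    exact tendsto_nhdsWithin_of_tendsto_nhds (hRcont.tendsto 1)
  refine hlim.congr' ?_
  filter_upwards [self_mem_nhdsWithin] with s (hs : 1 < s)
  rw [hdec s hs, Finset.sum_mul]
  have : ∑ i ∈ S, a i * (primeSeries (f i) s + c i * Real.log (s - 1)) =
      ∑ i ∈ S, a i * primeSeries (f i) s + ∑ i ∈ S, a i * c i * Real.log (s - 1) := by
    rw [← Finset.sum_add_distrib]
    exact Finset.sum_congr rfl fun i _ => by ring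
  rw [this]
  ring

/-- **Positive asymptotic forces infinite support.** If `Σ_p f(p) p^{-s} + c log (s-1)`
converges with `c > 0`, then `f p ≠ 0` for infinitely many primes `p` (a finite Dirichlet
polynomial stays bounded while `c log (s-1) → -∞`). [folklore] -/
theorem HasPrimeLogAsymp.infinite {f : ℕ → ℝ} {c : ℝ} (h : HasPrimeLogAsymp f c) (hc : 0 < c) :
    {p : Nat.Primes | f p ≠ 0}.Infinite := by
  intro hfin
  obtain ⟨L, hL⟩ := h
  set T : Finset Nat.Primes := hfin.toFinset with hT
  have hf0 : ∀ p : Nat.Primes, p ∉ T → f p = 0 := by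
    intro p hp
    rw [hT, Set.Finite.mem_toFinset] at hp
    simpa using hp
  set R : ℝ → ℝ := fun s => ∑ p ∈ T, f p * (p : ℝ) ^ (-s) with hR
  have hRcont : Continuous R := continuous_finsetSum_mul_rpow T fun p => f p
  have hser : ∀ s : ℝ, primeSeries f s = R s := fun s =>
    tsum_eq_sum (s := T) fun p hp => by rw [hf0 p hp, zero_mul]
  -- `c * log (s - 1) = (series + c log) - R s` would converge, but it tends to `-∞`
  have h1 : Tendsto (fun s : ℝ => c * Real.log (s - 1)) (𝓝[>] 1) (𝓝 (L - R 1)) := by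
    have := hL.sub (tendsto_nhdsWithin_of_tendsto_nhds (hRcont.tendsto 1))
    refine this.congr' ?_
    filter_upwards with s
    rw [hser s]
    ring
  have h2 : Tendsto (fun s : ℝ => c * Real.log (s - 1)) (𝓝[>] 1) atBot := by
    have hlog : Tendsto (fun s : ℝ => Real.log (s - 1)) (𝓝[>] 1) atBot := by
      have hsub : Tendsto (fun s : ℝ => s - 1) (𝓝[>] 1) (𝓝[>] 0) := by
        refine tendsto_nhdsWithin_iff.mpr ⟨?_, ?_⟩
        · have : Tendsto (fun s : ℝ => s - 1) (𝓝 1) (𝓝 (1 - 1)) :=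
            (continuous_sub_right (1 : ℝ)).tendsto 1
          rw [sub_self] at this
          exact tendsto_nhdsWithin_of_tendsto_nhds this
        · filter_upwards [self_mem_nhdsWithin] with s (hs : 1 < s)
          exact sub_pos.mpr hs
      exact Real.tendsto_log_nhdsGT_zero.comp hsub
    exact hlog.const_mul_atBot hc
  exact not_tendsto_nhds_of_tendsto_atBot h2 (L - R 1) h1

/-! ### Primes of a number field of given norm; strong Dirichlet density -/

variable (M : Type*) [Field M] [NumberField M]

/-- The set of nonzero primes of `𝓞 M` of absolute norm `p` is finite (there are finitely many
ideals of each norm, Mathlib `Ideal.finite_setOf_absNorm_eq`). [folklore] -/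
theorem finite_setOf_absNorm_asIdeal_eq (p : ℕ) :
    {q : HeightOneSpectrum (𝓞 M) | Ideal.absNorm q.asIdeal = p}.Finite := by
  have h : {q : HeightOneSpectrum (𝓞 M) | Ideal.absNorm q.asIdeal = p} =
      (fun q : HeightOneSpectrum (𝓞 M) => q.asIdeal) ⁻¹' {I | Ideal.absNorm I = p} := rfl
  rw [h]
  exact (Ideal.finite_setOf_absNorm_eq p).preimage fun q _ q' _ hqq' =>
    HeightOneSpectrum.ext hqq'

/-- The finite set of nonzero primes `𝔮` of `𝓞 M` with `N𝔮 = p`. [folklore] -/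
def primesOfNorm (p : ℕ) : Finset (HeightOneSpectrum (𝓞 M)) :=
  (finite_setOf_absNorm_asIdeal_eq M p).toFinset

variable {M} in
/-- Membership in `primesOfNorm`. [folklore] -/
@[simp]
theorem mem_primesOfNorm {p : ℕ} {q : HeightOneSpectrum (𝓞 M)} :
    q ∈ primesOfNorm M p ↔ Ideal.absNorm q.asIdeal = p := by
  simp [primesOfNorm]

/-- `#{𝔮 ∈ X : N𝔮 = p}`: the number of primes of `X` of absolute norm `p`. [folklore] -/
def primeNormCount (X : Set (HeightOneSpectrum (𝓞 M))) (p : ℕ) : ℕ :=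
  ((primesOfNorm M p).filter (· ∈ X)).card

variable {M}

/-- `#{𝔮 ∈ X : N𝔮 = p} = Σ_{N𝔮 = p} 1_X(𝔮)` (as a real number). [folklore] -/
theorem primeNormCount_eq_sum_indicator (X : Set (HeightOneSpectrum (𝓞 M))) (p : ℕ) :
    (primeNormCount M X p : ℝ) =
      ∑ q ∈ primesOfNorm M p, X.indicator (fun _ => (1 : ℝ)) q := by
  rw [primeNormCount, Finset.card_filter, Nat.cast_sum]
  refine Finset.sum_congr rfl fun q _ => ?_
  by_cases hq : q ∈ X <;> simp [hq]

/-- The primes of norm `p` inject into the ideals of norm `p`: `#{𝔮 ∈ X : N𝔮 = p} ≤ c_M(p)`.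
[folklore] -/
theorem primeNormCount_le_idealNormCount (X : Set (HeightOneSpectrum (𝓞 M))) (p : ℕ) :
    primeNormCount M X p ≤ idealNormCount M p := by
  classical
  rw [primeNormCount, idealNormCount]
  calc ((primesOfNorm M p).filter (· ∈ X)).card ≤ (primesOfNorm M p).card :=
        Finset.card_filter_le _ _
    _ = Fintype.card (primesOfNorm M p) := (Fintype.card_coe _).symm
    _ ≤ Nat.card {I : Ideal (𝓞 M) // Ideal.absNorm I = p} := by
        rw [← Nat.card_eq_fintype_card]
        refine Nat.card_le_card_of_injective
          (fun q => ⟨q.1.asIdeal, mem_primesOfNorm.mp q.2⟩) ?_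
        intro q q' h
        exact Subtype.ext (HeightOneSpectrum.ext (congrArg Subtype.val h))

/-- The crude bound `#{𝔮 ∈ X : N𝔮 = p} ≤ 2^{[M:ℚ]}` for `p` prime (via `c_M(p) ≤ 2^{[M:ℚ]}`,
tree `idealNormCount_prime_le`). [folklore] -/
theorem abs_primeNormCount_le (X : Set (HeightOneSpectrum (𝓞 M))) (p : Nat.Primes) :
    |(primeNormCount M X p : ℝ)| ≤ (2 : ℝ) ^ Module.finrank ℚ M := by
  rw [abs_of_nonneg (Nat.cast_nonneg _)]
  exact (Nat.cast_le.mpr (primeNormCount_le_idealNormCount X p)).trans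
    (idealNormCount_prime_le M p.prop)

/-- `#{𝔮 : N𝔮 = p}` (no condition) is the number of primes of norm `p`. [folklore] -/
theorem primeNormCount_univ_eq_card (p : ℕ) :
    primeNormCount M Set.univ p = (primesOfNorm M p).card := by
  classical
  unfold primeNormCount
  have h1 : ∀ inst : DecidablePred (· ∈ (Set.univ : Set (HeightOneSpectrum (𝓞 M)))),
      (@Finset.filter _ (· ∈ Set.univ) inst (primesOfNorm M p)).card = (primesOfNorm M p).card :=
    fun inst => congrArg Finset.card (Finset.filter_true_of_mem fun _ _ => Set.mem_univ _)
  rw [h1]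

/-- For a prime `p`, every ideal of norm `p` is a nonzero prime: `#{𝔮 : N𝔮 = p} = c_M(p)`.
[folklore] -/
theorem primeNormCount_univ {p : ℕ} (hp : p.Prime) :
    primeNormCount M Set.univ p = idealNormCount M p := by
  classical
  rw [primeNormCount_univ_eq_card, idealNormCount, ← Fintype.card_coe, ← Nat.card_eq_fintype_card]
  refine Nat.card_congr
    { toFun := fun q => ⟨q.1.asIdeal, mem_primesOfNorm.mp q.2⟩
      invFun := fun I => ⟨⟨I.1, ?_, ?_⟩, ?_⟩
      left_inv := fun q => by simp
      right_inv := fun I => by simp }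
  · exact Ideal.isPrime_of_irreducible_absNorm (I.2.symm ▸ hp)
  · intro h
    have := I.2
    rw [h, Ideal.absNorm_bot] at this
    exact hp.ne_zero this.symm
  · exact mem_primesOfNorm.mpr I.2

variable (M)

/-- The set `X` of primes of `M` **has strong Dirichlet density `c`**:
`Σ_{𝔮 ∈ X, N𝔮 = p prime} N𝔮^{-s} + c · log (s-1)` converges to a finite limit as `s → 1⁺`.
This refines "Dirichlet density `c`" (Neukirch VII (13.1): there `o(log 1/(s-1))` error and all
`𝔮 ∈ X`; the primes of degree `≥ 2` contribute a function regular at `s = 1`, loc. cit.,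
proof of (13.2)).  Not to be confused with the classical *logarithmic density*
`lim (1/log x) Σ_{n ≤ x, n ∈ X} 1/n` of a set of integers, a different notion.
[cite: NeukirchANT1999, VII (13.1)–(13.2)] -/
def HasStrongDirichletDensity (X : Set (HeightOneSpectrum (𝓞 M))) (c : ℝ) : Prop :=
  HasPrimeLogAsymp (fun p => (primeNormCount M X p : ℝ)) c

/-- Unfolding lemma for `HasStrongDirichletDensity`. [folklore] -/
theorem hasStrongDirichletDensity_iff {X : Set (HeightOneSpectrum (𝓞 M))} {c : ℝ} :
    HasStrongDirichletDensity M X c ↔ ∃ L : ℝ, Tendsto (fun s : ℝ =>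
      (∑' p : Nat.Primes, (primeNormCount M X p : ℝ) * (p : ℝ) ^ (-s)) + c * Real.log (s - 1))
      (𝓝[>] 1) (𝓝 L) :=
  Iff.rfl

/-- **The set of all primes has strong Dirichlet density `1`**:
`Σ_{N𝔮 = p prime} N𝔮^{-s} + log (s-1)` converges as `s → 1⁺` (Neukirch VII, proof of (13.2):
`log ζ_M(s) ∼ Σ_{deg 𝔮 = 1} N𝔮^{-s} ∼ log 1/(s-1)`; here from the tree's
`exists_tendsto_tsum_primes_idealNormCount_add_log`, i.e. the Euler product of `ζ_M` and Mathlib's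
class number formula residue). [cite: NeukirchANT1999, VII (13.2) (proof)] -/
theorem hasStrongDirichletDensity_univ : HasStrongDirichletDensity M Set.univ 1 := by
  obtain ⟨L, hL⟩ := exists_tendsto_tsum_primes_idealNormCount_add_log M
  refine ⟨L, hL.congr' ?_⟩
  filter_upwards with s
  rw [one_mul, primeSeries_def]
  congr 1
  exact tsum_congr fun p => by rw [primeNormCount_univ p.prop]

variable {M}

/-- **A set of primes of positive strong Dirichlet density is infinite.** [folklore] -/
theorem HasStrongDirichletDensity.infinite {X : Set (HeightOneSpectrum (𝓞 M))} {c : ℝ}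
    (h : HasStrongDirichletDensity M X c) (hc : 0 < c) : X.Infinite := by
  intro hX
  have hinf := HasPrimeLogAsymp.infinite h hc
  refine hinf ((hX.image fun q => Ideal.absNorm q.asIdeal).preimage
    (f := fun p : Nat.Primes => (p : ℕ)) (Nat.Primes.coe_nat_injective.injOn) |>.subset ?_)
  intro p hp
  simp only [Set.mem_setOf_eq, ne_eq, Nat.cast_eq_zero, primeNormCount,
    Finset.card_eq_zero, Finset.filter_eq_empty_iff, not_forall, not_not] at hp
  obtain ⟨q, hq, hqX⟩ := hp
  exact ⟨q, hqX, mem_primesOfNorm.mp hq⟩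

/-- **Linear relations transfer densities.** If `1_X = Σ_{i ∈ S} a_i 1_{X_i}` outside a finite
set of primes of `M` and `X_i` has strong Dirichlet density `c_i`, then `X` has strong Dirichlet
density `Σ a_i c_i` (used with Möbius coefficients in Frobenius' theorem, and with a single term
for finite modifications). [folklore] -/
theorem hasStrongDirichletDensity_of_forall_indicator_eq {ι : Type*} (S : Finset ι)
    {Xs : ι → Set (HeightOneSpectrum (𝓞 M))} {cs : ι → ℝ} (a : ι → ℝ)
    (hX : ∀ i ∈ S, HasStrongDirichletDensity M (Xs i) (cs i)) {X : Set (HeightOneSpectrum (𝓞 M))}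
    {E : Set (HeightOneSpectrum (𝓞 M))} (hE : E.Finite)
    (heq : ∀ q ∉ E, X.indicator (fun _ => (1 : ℝ)) q =
      ∑ i ∈ S, a i * (Xs i).indicator (fun _ => (1 : ℝ)) q) :
    HasStrongDirichletDensity M X (∑ i ∈ S, a i * cs i) := by
  refine HasPrimeLogAsymp.linear S (fun i _ p => abs_primeNormCount_le (Xs i) p) hX a
    (abs_primeNormCount_le X) ?_
  -- outside the finitely many primes below `E`, the counts satisfy the same relation
  have hfin : {p : Nat.Primes | ∃ q ∈ E, Ideal.absNorm q.asIdeal = p}.Finite := by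
    refine ((hE.image fun q => Ideal.absNorm q.asIdeal).preimage
      (f := fun p : Nat.Primes => (p : ℕ)) Nat.Primes.coe_nat_injective.injOn).subset ?_
    rintro p ⟨q, hq, hqp⟩
    exact ⟨q, hq, hqp⟩
  refine Filter.eventually_of_mem hfin.compl_mem_cofinite fun p hp => ?_
  simp only [Set.mem_compl_iff, Set.mem_setOf_eq, not_exists, not_and] at hp
  rw [primeNormCount_eq_sum_indicator]
  have : ∀ i ∈ S, a i * (primeNormCount M (Xs i) p : ℝ) =
      ∑ q ∈ primesOfNorm M p, a i * (Xs i).indicator (fun _ => (1 : ℝ)) q := fun i _ => by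
    rw [primeNormCount_eq_sum_indicator, Finset.mul_sum]
  rw [Finset.sum_congr rfl this, Finset.sum_comm]
  refine Finset.sum_congr rfl fun q hq => heq q fun hqE => hp q hqE (mem_primesOfNorm.mp hq)

/-- **Finite modifications do not change the density.** [folklore] -/
theorem HasStrongDirichletDensity.of_finite_symmDiff {X Y : Set (HeightOneSpectrum (𝓞 M))} {c : ℝ}
    (hX : HasStrongDirichletDensity M X c) {E : Set (HeightOneSpectrum (𝓞 M))} (hE : E.Finite)
    (heq : ∀ q ∉ E, q ∈ X ↔ q ∈ Y) : HasStrongDirichletDensity M Y c := by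
  have h := hasStrongDirichletDensity_of_forall_indicator_eq {(0 : ℕ)} (Xs := fun _ => X) (cs := fun _ => c)
    (fun _ => 1) (fun _ _ => hX) (X := Y) hE (fun q hq => by
      simp only [Finset.sum_singleton, one_mul]
      by_cases hqX : q ∈ X
      · simp [hqX, (heq q hq).mp hqX]
      · have : q ∉ Y := fun h => hqX ((heq q hq).mpr h)
        simp [hqX, this])
  simpa using h

/-- **Comparison of counts between two number fields.** If `Y` (primes of `N`) has strong
Dirichlet density `c` and `#{𝔔 ∈ Y : N𝔔 = p} = a · #{𝔮 ∈ X : N𝔮 = p}` for all but finitely many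
primes `p` (`a ≠ 0`), then `X` (primes of `M`) has strong Dirichlet density `c / a` — the shape in which
splitting laws ("a split prime of `M` has exactly `[N:M]` primes of `N` above it, of the same
norm") transfer densities. [folklore] -/
theorem hasStrongDirichletDensity_of_primeNormCount_eq {N : Type*} [Field N] [NumberField N]
    {Y : Set (HeightOneSpectrum (𝓞 N))} {c a : ℝ} (ha : a ≠ 0) (hY : HasStrongDirichletDensity N Y c)
    {X : Set (HeightOneSpectrum (𝓞 M))}
    (h : ∀ᶠ p : Nat.Primes in cofinite, (primeNormCount N Y p : ℝ) = a * primeNormCount M X p) :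
    HasStrongDirichletDensity M X (c / a) := by
  have := HasPrimeLogAsymp.linear {(0 : ℕ)} (f := fun _ p => (primeNormCount N Y p : ℝ))
    (c := fun _ => c) (fun _ _ p => abs_primeNormCount_le Y p) (fun _ _ => hY) (fun _ => a⁻¹)
    (g := fun p => (primeNormCount M X p : ℝ)) (abs_primeNormCount_le X) (h.mono fun p hp => by
      simp only [Finset.sum_singleton]
      rw [hp, ← mul_assoc, inv_mul_cancel₀ ha, one_mul])
  rw [HasStrongDirichletDensity, div_eq_inv_mul]
  simpa using this

end Literature.NumberTheory.LFunctions
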